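import Literature.AlgebraicGeometry.Resolution.BlowupSequencesExtensions
import Summits.ResolutionOfSingularities.ResolutionOfSingularities.Theorems.PurityValveClasses
import Summits.ResolutionOfSingularities.ResolutionOfSingularities.Theorems.ForcedTowerClasses
import Summits.ResolutionOfSingularities.ResolutionOfSingularities.Theorems.WeakOrderReduction
import Summits.ResolutionOfSingularities.ResolutionOfSingularities.Theorems.SatelliteExitClasses
import Summits.ResolutionOfSingularities.ResolutionOfSingularities.Theorems.ContactShadowClasses
import Literature.AlgebraicGeometry.Resolution.SmoothStalkLinearPartCriterion
import Literature.AlgebraicGeometry.Resolution.SmoothOfRegularPerfectField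
import Literature.AlgebraicGeometry.Resolution.DiffIdealStalk
import Literature.AlgebraicGeometry.Resolution.DiffIdealSupportOrder
import Literature.AlgebraicGeometry.Resolution.DiffIdealBlowupAlgebra
import Literature.AlgebraicGeometry.Resolution.DiffOpBlowupShiftLaw
import Literature.AlgebraicGeometry.Resolution.DiffOpBlowupStalkShift
import Literature.AlgebraicGeometry.Resolution.RegularImpliesSmooth
import Literature.AlgebraicGeometry.Resolution.DerivativeIdealSheaf
import Literature.AlgebraicGeometry.Resolution.RegularWeakTransformPrime
import Literature.AlgebraicGeometry.Resolution.BlowupSNC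
import Literature.AlgebraicGeometry.Resolution.BlowupOffCentre
import Literature.AlgebraicGeometry.Resolution.MonomialOrderReductionUnit
import Literature.AlgebraicGeometry.Resolution.HypersurfaceTransform
import Literature.AlgebraicGeometry.Resolution.ColonIdealSheafFG
import Literature.AlgebraicGeometry.Resolution.SharpOrderCoordinateCentre
import Literature.AlgebraicGeometry.Resolution.RegularSubschemeLocallyIrreducible
import Literature.AlgebraicGeometry.Resolution.GenericPointStalkData
import Literature.AlgebraicGeometry.Resolution.RegularLocalRingsQuotient
import Literature.AlgebraicGeometry.Resolution.KollarTripleMaxOrd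
import Summits.ResolutionOfSingularities.ResolutionOfSingularities.Theorems.AbsoluteContactPrimitives
import Summits.ResolutionOfSingularities.ResolutionOfSingularities.Theorems.PurityValveClasses
import Summits.ResolutionOfSingularities.ResolutionOfSingularities.Theorems.ForcedTowerClasses
import Summits.ResolutionOfSingularities.ResolutionOfSingularities.Theorems.SatelliteExitClasses
import Summits.ResolutionOfSingularities.ResolutionOfSingularities.Theorems.ContactShadowClasses
import HarnessLib

/-!
# AbsoluteContactScope — decomp-res node «AbsoluteGiraud» (lens-6 g16), tree file 1/7: §0 the g12 vocabulary
over the LANDED `Branch`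
(`ExitCurveAt`, `Branch.EscapingC`, `Branch.HugsTop`; namespace `SatelliteExitClasses`) and §1 THE SCOPE CLASS BY
NAME: `HugClass3On`, `AllHug3Off3`
(the `p ≠ 3` slice of «every admissible core pure C-escaping branch at marking 3 hugs a top curve»), the side
/-- ``NoCoreOff3Perf``: Auxiliary step of this node's calculus, VERBATIM from the lens file (see the module
docstring); the statement is its type. [folklore] -/
lemma `NoCoreOff3Perf` KERNEL-PROVED
(`noCoreOff3Perf`: over a perfect field of characteristic `p ≠ 3` no closed point is a core point at marking 3 —
Hasse contact V0), the split
`AllHug3Off3 ↔ AllHug3Off3Perf ∧ AllHug3Off3Imp` with the perfect half PROVED, hence `allHug3Off3_iff_imp`.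

Content VERBATIM from the decomp-res lens-6 g16 file `HOME/decomp-res-lens-6/g16/AbsoluteGiraud.lean` (sha256
bc25b5879a7322cd; CRITIC-LEDGER row 118
CLEARED: MAP +1; it SUPERSEDES g15 `AbsoluteContact.lean` cca8a261, rows 110–112, whose §1–§5 are
byte-identical).  HOME = run/shared/lean/pub/decomp-res.
Host: route `MaxContactCut`, aside 31574 `PVPureGame` through the lens-6 chain SatelliteExit (tree
`Theorems/SatelliteExitClasses`) → g12–g14
BoundaryValve / SwitchExclusion / MemberCalculus (HOME, critic rows 87/93/103; not yet in the tree) → the scope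
class `AllHug3Off3` (§1 here).

[WRITER NOTE (decomp-res writer g6): the lens file is split into `AbsoluteContactScope` (§0 g12 vocabulary over the
landed `Branch` + §1 the
scope class and the perfect half) → `AbsoluteContactPrimitives` (§2, landed earlier) →
`AbsoluteContactHasseRing` / `AbsoluteContactHasse` (§3a/§3
the separable-residue Hasse lemma IN KERNEL) → `AbsoluteContactAxes` (§4/§5 the two axes: residue field of the
root point; absolute contact) →
`AbsoluteGiraudKernel` (§6 scheme-level Giraud persistence of absolute contact under one blowing up) →
`AbsoluteGiraudBranch` (§7 `absGiraud3`,
§8 assembly).  The two Theses-cone imports of the lens file (`Theses.MaxContactCut`, `MaxContactCutPurityValve`)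
are unused and dropped, so every
file is route-importable; `set_option` lines dropped; nothing else changed.]
(Sources: Giraud1975; EncinasVillamayor2000 Thm. 4.9; BravoGarciaEscamillaVillamayor2012 Lemma 4.6;
VillamayorU2008ReesDiff §4; CossartPiltant2008 §2; CossartJannsenSaito2020.)
-/

noncomputable section

open CategoryTheory AlgebraicGeometry TopologicalSpace
open Literature.AlgebraicGeometry.Resolution
open Summit.ResolutionOfSingularities.ResolutionOfSingularities.Theorems
open WeakOrderReduction ForcedTowerClasses PurityValveClasses

/-! ## §0 The g12 vocabulary over the LANDED `Branch` (g14 §0 VERBATIM; not yet in the tree) -/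

namespace Summit.ResolutionOfSingularities.ResolutionOfSingularities.Theorems.SatelliteExitClasses

variable {k : Type} [Field k]

/-- **EXIT CURVE at stage `i`** (g12 verbatim): a globally regular curve `C ∋ pt i`, positive-dimensional at `pt
i`, inside the top
locus `supp (D i)`. DEFINITION (support). -/
def ExitCurveAt (B : Branch k) (i : ℕ) : Prop :=
  ∃ C : (B.St i).IdealSheafData, Scheme.IsRegular C.subscheme ∧ B.pt i ∈ (C.support : Set (B.St i)) ∧
    ¬ IsIsolatedIn (C.support : Set (B.St i)) (B.pt i) ∧ (C.support : Set (B.St i)) ⊆ (B.D i).support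

/-- pure logic: a boundary exit line is an exit curve (g12 verbatim). [folklore] -/
theorem exitCurveAt_of_exitLineAt {B : Branch k} {i : ℕ} (h : ExitLineAt B i) : ExitCurveAt B i := by
  obtain ⟨C, hreg, hpt, hiso, hsub, -⟩ := h
  exact ⟨C, hreg, hpt, hiso, hsub⟩

/-- **ESCAPING (repaired)** (g12 verbatim): at no point round does the followed point carry an exit CURVE.
DEFINITION (support). -/
def Branch.EscapingC (B : Branch k) : Prop :=
  ∀ i, B.PointRound i → ¬ ExitCurveAt B i

/-- pure logic (g12 verbatim). [folklore] -/
theorem Branch.escaping_of_escapingC {B : Branch k} (h : B.EscapingC) : B.Escaping :=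
  fun i hi hL => h i hi (exitCurveAt_of_exitLineAt hL)

/-- **HUGS A TOP CURVE** (g12 verbatim): from some stage `m` on the branch follows the strict transforms of a germ
`V(H) ∋ pt m`
inside the top locus, of dimension one at `pt m`. DEFINITION (support). -/
def Branch.HugsTop (B : Branch k) : Prop :=
  ∃ (m : ℕ) (H : (B.St m).IdealSheafData), HugsGerm B m H ∧ (H.support : Set (B.St m)) ⊆ (B.D m).support ∧
    ringKrullDim ((B.St m).presheaf.stalk (B.pt m) ⧸ stalkIdeal H (B.pt m)) = (1 : WithBot ℕ∞)

end Summit.ResolutionOfSingularities.ResolutionOfSingularities.Theorems.SatelliteExitClasses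

namespace Summit.ResolutionOfSingularities.ResolutionOfSingularities.Theorems.AbsoluteContactClasses

open SatelliteExitClasses

/-! ## §1 The target by name: g13/g14's scope aside `AllHug3Off3` and g14 §6 VERBATIM (perfect half KERNEL-PROVED) -/

/-- «Every admissible branch AT A PRIME `p` WITH `Q p`, with property `P`, hugs a top curve» (g13 §2 verbatim).
DEFINITION (support). -/
def HugClass3On (Q : ℕ → Prop) (P : ∀ (k : Type) [Field k], Branch k → Prop) : Prop :=
  ∀ p : ℕ, p.Prime → Q p → ∀ (k : Type) [Field k] [CharP k p] (B : Branch k),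
    IsDatum 3 (B.D 0) → (B.D 0).boundary = [] → AllCorePure p (B.str 0) (B.base 0).isRegular (B.D 0).ideal 3 →
      B.Core → B.Pure p → B.EscapingC → P k B → B.HugsTop

/-- **the scope aside `AllHug3Off3`** (g13/g14 verbatim): the `p ≠ 3` slice of `AllHug3`. -/
def AllHug3Off3 : Prop := HugClass3On (· ≠ 3) fun _ _ _ => True

/-- **side lemma · `NoCoreOff3Perf`** (g14 §6 verbatim; KERNEL-PROVED `noCoreOff3Perf`). -/
def NoCoreOff3Perf : Prop :=
  ∀ p : ℕ, p.Prime → p ≠ 3 → ∀ (k : Type) [Field k] [CharP k p] [PerfectField k] (Y : Scheme.{0})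
    (g : Y ⟶ Spec (.of k)) (hB : IsBase Y g) (I : Y.IdealSheafData) (y : Y),
      IsClosed ({y} : Set Y) → ¬ IsCorePt g hB.isRegular I 3 y

/-- **HASSE CONTACT LEMMA (V0), scheme form — PROVED** (g14 §6 verbatim). (Sources: VillamayorU2008ReesDiff,
§4.1 and Remark 4.3.) -/
theorem isContactPt_of_idealOrder_eq_three {p : ℕ} (hp : p.Prime) (hp3 : p ≠ 3) {k : Type} [Field k] [CharP k p]
    [PerfectField k] {Y : Scheme.{0}} (g : Y ⟶ Spec (.of k)) (hB : IsBase Y g) (I : Y.IdealSheafData) {y : Y}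
    (hy : IsClosed ({y} : Set Y)) (hord : idealOrder I y = ((3 : ℕ) : ℕ∞)) : IsContactPt g I 3 y := by
  haveI : LocallyOfFiniteType g := hB.locallyOfFiniteType
  haveI : Smooth g := smooth_of_isRegular_of_perfectField g hB.isRegular
  set φ : k →+* Γ(Y, ⊤) := g.appTop.hom.comp (Scheme.ΓSpecIso (.of k)).inv.hom with hφ
  have hft : HasFiniteTypeSections φ := hasFiniteTypeSections_of_locallyOfFiniteType k g
  -- an element of the stalk ideal of order exactly `3`
  have hle : stalkIdeal I y ≤ IsLocalRing.maximalIdeal (Y.presheaf.stalk y) ^ 3 := (le_idealOrder_iff I y 3).mp hord.ge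
  have hnle : ¬ stalkIdeal I y ≤ IsLocalRing.maximalIdeal (Y.presheaf.stalk y) ^ 4 := by
    intro h
    have h1 := (le_idealOrder_iff I y 4).mpr h
    rw [hord] at h1
    exact absurd (ENat.coe_le_coe.mp h1) (by omega)
  obtain ⟨h, hhI, hh4⟩ : ∃ h ∈ stalkIdeal I y, h ∉ IsLocalRing.maximalIdeal (Y.presheaf.stalk y) ^ 4 := by
    by_contra hcon
    push Not at hcon
    exact hnle hcon
  have hh3 : h ∈ IsLocalRing.maximalIdeal (Y.presheaf.stalk y) ^ (2 + 1) := hle hhI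
  have hh4' : h ∉ IsLocalRing.maximalIdeal (Y.presheaf.stalk y) ^ (2 + 2) := hh4
  have hp3' : ¬ p ∣ 2 + 1 := fun hd => hp3 ((Nat.prime_dvd_prime_iff_eq hp Nat.prime_three).mp hd)
  -- Hasse–Schmidt: an operator of order `≤ 2` taking `h` to an element of `𝔪_y`-adic order `1`
  letI := stalkAlgebra φ y
  obtain ⟨D, hD, hz⟩ := exists_isDiffOpLE_adicOrder_eq_one_stalk_of_smooth g p y hy hh3 hh4' hp3'
  set J : Y.IdealSheafData := diffIdealSheaf φ 2 I with hJ
  have hzJ : D h ∈ stalkIdeal J y := by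
    rw [hJ, stalkIdeal_diffIdealSheaf hft]
    exact apply_mem_diffIdeal k hD hhI
  have hz1 := (adicOrder_eq_one_iff (D h)).mp hz
  have hJ2 : ¬ stalkIdeal J y ≤ IsLocalRing.maximalIdeal (Y.presheaf.stalk y) ^ 2 := fun hle2 => hz1.2 (hle2 hzJ)
  -- a section on an affine neighbourhood with germ in `𝔪_y ∖ 𝔪_y²`
  obtain ⟨U', hU', hyU', -⟩ := exists_isAffineOpen_mem_and_subset (X := Y) (x := y) (U := ⊤) (Opens.mem_top y)
  set U : Y.affineOpens := ⟨U', hU'⟩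
  obtain ⟨u, huJ, hu2⟩ := exists_section_germ_not_mem_sq J hJ2 U hyU'
  have hyJ : y ∈ J.support := by
    rw [hJ]
    exact mem_support_diffIdealSheaf_of_le_idealOrder hft I (by rw [hord])
  have hum : (Y.presheaf.germ U y hyU').hom u ∈ IsLocalRing.maximalIdeal (Y.presheaf.stalk y) := by
    have h1 : (Y.presheaf.germ U y hyU').hom u ∈ stalkIdeal J y := by
      rw [stalkIdeal_eq_map_germ J U hyU']
      exact Ideal.mem_map_of_mem _ huJ
    exact (mem_support_iff_stalkIdeal_le J y).mp hyJ h1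
  exact ⟨U, hyU', u, huJ, hum, hu2⟩

/-- **`NoCoreOff3Perf` — KERNEL-PROVED** (g14 §6 verbatim). (Sources: VillamayorU2008ReesDiff, §4.1 and Remark 4.3.) -/
theorem noCoreOff3Perf : NoCoreOff3Perf := by
  intro p hp hp3 k _ _ _ Y g hB I y hy hcore
  exact hcore.2 (Or.inr (Or.inl (isContactPt_of_idealOrder_eq_three hp hp3 g hB I hy hcore.1)))

/-- **aside · `AllHug3Off3Perf`** — the `p ≠ 3` slice over PERFECT fields (g14 §6 verbatim; PROVED
`allHug3Off3Perf_holds`). -/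
def AllHug3Off3Perf : Prop :=
  ∀ p : ℕ, p.Prime → p ≠ 3 → ∀ (k : Type) [Field k] [CharP k p] (B : Branch k), PerfectField k →
    IsDatum 3 (B.D 0) → (B.D 0).boundary = [] → AllCorePure p (B.str 0) (B.base 0).isRegular (B.D 0).ideal 3 →
      B.Core → B.Pure p → B.EscapingC → B.HugsTop

/-- **aside · `AllHug3Off3Imp`** — the `p ≠ 3` slice over IMPERFECT fields (g14 §6 verbatim): g14's «root
seam»; THIS node's target. -/
def AllHug3Off3Imp : Prop :=
  ∀ p : ℕ, p.Prime → p ≠ 3 → ∀ (k : Type) [Field k] [CharP k p] (B : Branch k), ¬ PerfectField k →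
    IsDatum 3 (B.D 0) → (B.D 0).boundary = [] → AllCorePure p (B.str 0) (B.base 0).isRegular (B.D 0).ideal 3 →
      B.Core → B.Pure p → B.EscapingC → B.HugsTop

/-- **kernel (EXACT)** (g14 verbatim): the scope aside splits by perfection of the ground field. [folklore] -/
theorem allHug3Off3_iff_perf : AllHug3Off3 ↔ AllHug3Off3Perf ∧ AllHug3Off3Imp := by
  classical
  constructor
  · intro h
    exact ⟨fun p hp hp3 k _ _ B _ hD hb hA hC hPu hE => h p hp hp3 k B hD hb hA hC hPu hE trivial,
      fun p hp hp3 k _ _ B _ hD hb hA hC hPu hE => h p hp hp3 k B hD hb hA hC hPu hE trivial⟩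
  · rintro ⟨hP, hI⟩ p hp hp3 k _ _ B hD hb hA hC hPu hE -
    by_cases hk : PerfectField k
    · exact hP p hp hp3 k B hk hD hb hA hC hPu hE
    · exact hI p hp hp3 k B hk hD hb hA hC hPu hE

/-- **kernel (PROVED)** (g14 verbatim): no core points ⟹ the perfect-field slice holds VACUOUSLY. [folklore] -/
theorem allHug3Off3Perf_of_noCore (h : NoCoreOff3Perf) : AllHug3Off3Perf := by
  intro p hp hp3 k _ _ B hk hD hb hA hC hPu hE
  haveI := hk
  exact (h p hp hp3 k (B.St 0) (B.str 0) (B.base 0) (B.D 0).ideal (B.pt 0) (B.isClosed_pt 0) (hC 0)).elim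

/-- **PROVED** (g14 verbatim): the perfect-field slice of the aside holds outright. [folklore] -/
theorem allHug3Off3Perf_holds : AllHug3Off3Perf := allHug3Off3Perf_of_noCore noCoreOff3Perf

/-- the aside IS its imperfect-field half (g14 verbatim). [folklore] -/
theorem allHug3Off3_iff_imp : AllHug3Off3 ↔ AllHug3Off3Imp :=
  allHug3Off3_iff_perf.trans ⟨fun h => h.2, fun h => ⟨allHug3Off3Perf_holds, h⟩⟩

end Summit.ResolutionOfSingularities.ResolutionOfSingularities.Theorems.AbsoluteContactClasses
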